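import Summits.QuantumFields.YangMills.Theorems.UnitScaleTiltProp7FibreLevelMassT3
import Summits.QuantumFields.YangMills.Theorems.UnitScaleTiltProp7FibreLevelMassPerLevelT3
import Summits.QuantumFields.YangMills.Theorems.UnitScaleTiltProp7JointRowOfSuppliers
import HarnessLib

/-!
# Route `UnitScaleTilt`, crux K1 «MinimiserStabilityRegPr» (stmt-QuantumFields-19200), route-R E′ S3 (P′), row `hq`, file B1 (LETTERS) —
# THE TRUE LINEARISED ITERATE OF ANY BOND FIELD IN `ℓ²` (d = 3, `SU(2)`): `Σ_c‖Q^{(K−n)}R(c)‖² ≤ (9∕2·ℓ⁻¹ + 576000·L⁴·ℓ + 9.6·10¹⁰·L⁹·ε·ℓ⁻¹)·Σ_b‖R(b)‖²`,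
# the stencil bound `Σ_{x,μ<ν}‖(D_W R)(p_{μν}(x))‖²_HS ≤ 96·Σ_b‖R(b)‖²`, and the member's scalar windows (pure reals)

Cell `ym3-torus`, D-0154 (3c) twin-width seat `ym-routeR-w2` (gen 6); ★p1 g16 NAMER WORD 6 (ii) «hq DEFECT ROW», WORD 10 «FILES A∕B GO» (2026-08-28 23:55Z).  THEOREMS ONLY
(0 `def`, 0 `sorry`); `--supports stmt-QuantumFields-19200`, count-neutral.  YM₃ on T³ is a ladder rung (R3), not the Clay problem; nothing here claims the stub, the crux, E′,
d = 4 or the mass gap.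

THE POINT.  The member defect row `hq` (file B2 `…Prop7LinAvgDefectOfExactFibrePoint`) reads the sharp fibre budget (file A2 ✓ `…Prop7TrueLinIterSharpFibreT3`) at
`Y₀ = YW* − 1` and must pass to the chart `D = −i·log(YW⁻¹)`: `Q D = −i·Q(Y₀) + i·Q(Z′)`, `Z′ = Y₀ − iD = O(D²)` bondwise.  For the junk `Q(Z′)` one needs the `ℓ²` size of the true
linearised iterate of a GENERIC bond field — not a contraction (pure gauges are not contracted), but bounded k-uniformly: the structure theorem ✓ `Prop7FibreLevelMass.
sqrt_sum_normSq_trueLinIter_le_of_structure` (`‖Q k R‖ ≤ ρᵏE_k‖R‖ + 2√d‖Λ_k(R)‖`, `ρ^{2k} = ℓ⁻¹`, `E_k ≤ 3∕2`) plus ★routeR-w2 g2's `(H¹)*` row at the top level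
(✓ `Prop7FibreLevelMassT3Letters.sum_normSq_covIterLambda_le_level`: `Σ‖Λ_k‖² ≤ ℓ(200L⁴(CURL+DIV) + 4·10⁹L⁹εℓ⁻²Σ‖R‖²)`) with the two stencil bounds `CURL_HS ≤ 96Σ‖R‖²` (§1: the
covariant curl on a plaquette is the four-term transported sum ✓ `curl_bg_eq`, `HS ≤ 2·op²`, `(a+b+c+d)² ≤ 4Σ`, incidence `4d = 12` ✓ `sum_plaq_bonds_le`) and `DIV ≤ 24Σ‖R‖²`
(✓ `Prop7HessWOfFibreCoreT3Rows.sum_hs_divB_le`); the recursion families of record are obtained inside (zero content).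

WHAT IS PROVED (ns `…Theorems.Prop7LinAvgDefectLetters`): `sum_hs_curl_le_mass`, ★ `sum_normSq_trueLinIter_le_mass_T3`, `twoBlock_number`, `member_numerals` (the scalar windows of
file B2's member row: `8·10¹¹L⁹sQ ≤ 1`, `10¹⁴L⁹e ≤ 1`, `L ≥ 3` ⇒ the number of ✓ `twoBlockMass_le_of_plaqBound_T3` and the final three-slot arithmetic).
HONEST SCOPE.  Bookkeeping over landed theorems; nothing of [Balaban1985Averaging] is asserted beyond the cited tree theorems.

References: T. Bałaban, CMP 95 (1984) 17–40 [Balaban1984PropagatorsI] ((1.18)–(1.20) pp.19–20); CMP 98 (1985) 17–51 [Balaban1985Averaging] (Prop. 3 (124)–(126) p.36);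
CMP 99 (1985) 389–434 [Balaban1985BackgroundPropagators] ((3.3)–(3.4) pp.390–391, (3.8) p.392, Thm 3.11 p.416).
-/

set_option autoImplicit false

noncomputable section

open scoped BigOperators Matrix.Norms.L2Operator Matrix

namespace Summit.QuantumFields.YangMills.Theorems.Prop7LinAvgDefectLetters

open Literature.MathematicalPhysics.QuantumFieldTheory.Balaban1983to89
open Literature.MathematicalPhysics.QuantumFieldTheory.Balaban1983to89.T3ContinuumYM3Torus
open Finset T4Continuum T4ReflectionCone BlockAveraging AveragingRT ExpMeanLog BlockAveragingEMLLinearised BlockAveragingEMLLinearisedBackground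
  BlockAveragingEMLProp2 B1RG242Torus
open B9Eq39Adjoint (curl divB)
open B10Eq27TorusAxialLog (holT unitsField toUField)
open B9TorusCalculus (torusT)
open Summit.QuantumFields.YangMills.Theorems.Prop7CurvedLandauKnitT3 (smallness_T3 three_le_L)
open Summit.QuantumFields.YangMills.Theorems.Prop7CurvedLandauRowE (loop_size_geom size_numerals)
open Summit.QuantumFields.YangMills.Theorems.Prop7CovIterLambdaBound (tower_plaq_lt plaqSmall_of_le_of_lt)
open Summit.QuantumFields.YangMills.Theorems.Prop7CurvedLandauRowA (exists_reduced_family exists_coarseGauge_family)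
open Summit.QuantumFields.YangMills.Theorems.Prop7LineIterVsEngineOfTower (exists_pureLine_family)
open Summit.QuantumFields.YangMills.Theorems.Prop7FibreLevelMass (sqrt_sum_normSq_trueLinIter_le_of_structure)
open Summit.QuantumFields.YangMills.Theorems.Prop7FibreLevelMassT3Letters (rho_facts two_sqrt_d_facts level_exp_le sum_normSq_covIterLambda_le_level)
open Summit.QuantumFields.YangMills.Theorems.Prop7CovariantCoercivity (curl_bg_eq sum_plaq_eq_sum_ite sum_norm_sq_le_mul_opNorm_sq)
open Summit.QuantumFields.YangMills.Theorems.Prop7FlatLocalMin (sum_plaq_bonds_le)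
open Summit.QuantumFields.YangMills.Theorems.PerturbedPlaquette (norm_conj_SU)
open Summit.QuantumFields.YangMills.Theorems.Prop7HessWOfFibreCoreT3Rows (sum_hs_divB_le)

/-! ## §1 The covariant curl in Hilbert–Schmidt is bounded by the mass -/

/-- **STENCIL BOUND FOR THE CURL**: `Σ_{x,μ<ν}Σ_jk|(D_W R)(p_{μν}(x))_jk|² ≤ 96·Σ_b‖R(b)‖²` for every bond field `R` on T³ (`SU(2)` background `W`): the covariant curl on a
plaquette is the four-term transported sum (✓ `curl_bg_eq`), `HS ≤ 2·op²` on `M₂(ℂ)`, `(a+b+c+d)² ≤ 4(a²+b²+c²+d²)`, and the plaquette–bond incidence `4d = 12` (✓ `sum_plaq_bonds_le`).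
[cite: Balaban1985BackgroundPropagators, (3.3)-(3.4) pp.390-391] -/
theorem sum_hs_curl_le_mass {F : T3Family} {K : ℕ} (W : GaugeField (F.P K) 0 (Matrix.specialUnitaryGroup (Fin 2) ℂ))
    (R : PBond (F.P K) 0 → Matrix (Fin 2) (Fin 2) ℂ) :
    (∑ x : Site (F.P K) 0, ∑ μ : Fin (F.P K).d, ∑ ν : Fin (F.P K).d,
        (if μ < ν then ∑ j : Fin 2, ∑ k : Fin 2,
          ‖(curl (torusT (F.P K) 0) (fun κ z => unitsField (toUField W) ⟨z, κ⟩) (fun κ z => R ⟨z, κ⟩) μ ν x) j k‖ ^ 2 else 0))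
      ≤ 96 * ∑ b : PBond (F.P K) 0, ‖R b‖ ^ 2 := by
  rw [← sum_plaq_eq_sum_ite (fun x μ ν => ∑ j : Fin 2, ∑ k : Fin 2,
      ‖(curl (torusT (F.P K) 0) (fun κ z => unitsField (toUField W) ⟨z, κ⟩) (fun κ z => R ⟨z, κ⟩) μ ν x) j k‖ ^ 2)]
  have hd : ((F.P K).d : ℝ) = 3 := by norm_num [T3Family.P_d]
  have hper : ∀ p : Plaq (F.P K) 0, ∑ j : Fin 2, ∑ k : Fin 2,
      ‖(curl (torusT (F.P K) 0) (fun κ z => unitsField (toUField W) ⟨z, κ⟩) (fun κ z => R ⟨z, κ⟩) p.μ p.ν p.src) j k‖ ^ 2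
        ≤ 8 * (‖R ⟨p.src, p.μ⟩‖ ^ 2 + ‖R ⟨p.src.shift p.μ, p.ν⟩‖ ^ 2 + ‖R ⟨p.src.shift p.ν, p.μ⟩‖ ^ 2 + ‖R ⟨p.src, p.ν⟩‖ ^ 2) := by
    intro p
    rw [curl_bg_eq W R p]
    have hHS := sum_norm_sq_le_mul_opNorm_sq (R ⟨p.src, p.μ⟩ + (W ⟨p.src, p.μ⟩ : Matrix (Fin 2) (Fin 2) ℂ) * R ⟨p.src.shift p.μ, p.ν⟩ * star (W ⟨p.src, p.μ⟩ : Matrix (Fin 2) (Fin 2) ℂ)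
        - (W ⟨p.src, p.ν⟩ : Matrix (Fin 2) (Fin 2) ℂ) * R ⟨p.src.shift p.ν, p.μ⟩ * star (W ⟨p.src, p.ν⟩ : Matrix (Fin 2) (Fin 2) ℂ) - R ⟨p.src, p.ν⟩)
    push_cast at hHS
    have h2 : ‖(W ⟨p.src, p.μ⟩ : Matrix (Fin 2) (Fin 2) ℂ) * R ⟨p.src.shift p.μ, p.ν⟩ * star (W ⟨p.src, p.μ⟩ : Matrix (Fin 2) (Fin 2) ℂ)‖ = ‖R ⟨p.src.shift p.μ, p.ν⟩‖ :=
      norm_conj_SU _ _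
    have h3 : ‖(W ⟨p.src, p.ν⟩ : Matrix (Fin 2) (Fin 2) ℂ) * R ⟨p.src.shift p.ν, p.μ⟩ * star (W ⟨p.src, p.ν⟩ : Matrix (Fin 2) (Fin 2) ℂ)‖ = ‖R ⟨p.src.shift p.ν, p.μ⟩‖ :=
      norm_conj_SU _ _
    have hn : ‖R ⟨p.src, p.μ⟩ + (W ⟨p.src, p.μ⟩ : Matrix (Fin 2) (Fin 2) ℂ) * R ⟨p.src.shift p.μ, p.ν⟩ * star (W ⟨p.src, p.μ⟩ : Matrix (Fin 2) (Fin 2) ℂ)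
        - (W ⟨p.src, p.ν⟩ : Matrix (Fin 2) (Fin 2) ℂ) * R ⟨p.src.shift p.ν, p.μ⟩ * star (W ⟨p.src, p.ν⟩ : Matrix (Fin 2) (Fin 2) ℂ) - R ⟨p.src, p.ν⟩‖
        ≤ ‖R ⟨p.src, p.μ⟩‖ + ‖R ⟨p.src.shift p.μ, p.ν⟩‖ + ‖R ⟨p.src.shift p.ν, p.μ⟩‖ + ‖R ⟨p.src, p.ν⟩‖ := by
      rw [← h2, ← h3]
      exact (norm_sub_le _ _).trans (add_le_add ((norm_sub_le _ _).trans (add_le_add (norm_add_le _ _) le_rfl)) le_rfl)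
    have h0 : 0 ≤ ‖R ⟨p.src, p.μ⟩ + (W ⟨p.src, p.μ⟩ : Matrix (Fin 2) (Fin 2) ℂ) * R ⟨p.src.shift p.μ, p.ν⟩ * star (W ⟨p.src, p.μ⟩ : Matrix (Fin 2) (Fin 2) ℂ)
        - (W ⟨p.src, p.ν⟩ : Matrix (Fin 2) (Fin 2) ℂ) * R ⟨p.src.shift p.ν, p.μ⟩ * star (W ⟨p.src, p.ν⟩ : Matrix (Fin 2) (Fin 2) ℂ) - R ⟨p.src, p.ν⟩‖ := norm_nonneg _
    have hsq := pow_le_pow_left₀ h0 hn 2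
    nlinarith [hHS, hsq, sq_nonneg (‖R ⟨p.src, p.μ⟩‖ - ‖R ⟨p.src.shift p.μ, p.ν⟩‖), sq_nonneg (‖R ⟨p.src.shift p.ν, p.μ⟩‖ - ‖R ⟨p.src, p.ν⟩‖),
      sq_nonneg (‖R ⟨p.src, p.μ⟩‖ + ‖R ⟨p.src.shift p.μ, p.ν⟩‖ - ‖R ⟨p.src.shift p.ν, p.μ⟩‖ - ‖R ⟨p.src, p.ν⟩‖)]
  have hinc := sum_plaq_bonds_le (P := F.P K) (j := 0) (fun b => ‖R b‖ ^ 2) (fun b => sq_nonneg _)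
  rw [hd] at hinc
  calc ∑ p : Plaq (F.P K) 0, ∑ j : Fin 2, ∑ k : Fin 2,
        ‖(curl (torusT (F.P K) 0) (fun κ z => unitsField (toUField W) ⟨z, κ⟩) (fun κ z => R ⟨z, κ⟩) p.μ p.ν p.src) j k‖ ^ 2
      ≤ ∑ p : Plaq (F.P K) 0, 8 * (‖R ⟨p.src, p.μ⟩‖ ^ 2 + ‖R ⟨p.src.shift p.μ, p.ν⟩‖ ^ 2 + ‖R ⟨p.src.shift p.ν, p.μ⟩‖ ^ 2 + ‖R ⟨p.src, p.ν⟩‖ ^ 2) :=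
        Finset.sum_le_sum fun p _ => hper p
    _ = 8 * ∑ p : Plaq (F.P K) 0, (‖R ⟨p.src, p.μ⟩‖ ^ 2 + ‖R ⟨p.src.shift p.μ, p.ν⟩‖ ^ 2 + ‖R ⟨p.src.shift p.ν, p.μ⟩‖ ^ 2 + ‖R ⟨p.src, p.ν⟩‖ ^ 2) := by
        rw [Finset.mul_sum]
    _ ≤ 8 * (4 * 3 * ∑ b : PBond (F.P K) 0, ‖R b‖ ^ 2) := mul_le_mul_of_nonneg_left hinc (by norm_num)
    _ = 96 * ∑ b : PBond (F.P K) 0, ‖R b‖ ^ 2 := by ring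

/-! ## §2 The true linearised iterate of ANY bond field in `ℓ²` (d = 3, `SU(2)`) -/

set_option maxHeartbeats 400000 in
/-- ★ **THE `ℓ²` SIZE OF THE TRUE LINEARISED ITERATE OF A GENERIC BOND FIELD.**  Background `U₀ ∈ SU(2)` on the finest torus of run `K` with `dist1(U₀(∂p)) ≤ εℓ⁻²`
(`ℓ = L^{K−n}`, `0 < ε`, `10⁶L⁵ε ≤ 1`); `Q` the true linearised iterate at `U₀` (`hQ0`, `hQs`); `R` ANY bond field.  Then
`Σ_c‖Q^{(K−n)}R(c)‖² ≤ (9∕2·ℓ⁻¹ + 576000·L⁴·ℓ + 9.6·10¹⁰·L⁹·ε·ℓ⁻¹)·Σ_b‖R(b)‖²` — the structure theorem (✓ `sqrt_sum_normSq_trueLinIter_le_of_structure`: reduced part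
`ρᵏE_k‖R‖`, `ρ^{2k} = ℓ⁻¹`, `E_k ≤ 3∕2`) plus ★routeR-w2's `(H¹)*` row at the top level (✓ `sum_normSq_covIterLambda_le_level`) with the stencil bounds `CURL ≤ 96·Σ‖R‖²` (§1),
`DIV ≤ 24·Σ‖R‖²` (✓ `sum_hs_divB_le`); families of record obtained inside (zero content).  No smallness of `R` is needed: it is a linear-operator letter.
[cite: Balaban1984PropagatorsI, (1.18)-(1.20) pp.19-20; Balaban1985Averaging, Prop. 3 (124)-(126) p.36; Balaban1985BackgroundPropagators, Thm 3.11 p.416] -/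
theorem sum_normSq_trueLinIter_le_mass_T3 (F : T3Family) (n K : ℕ)
    (U₀ : GaugeField (F.P K) 0 (Matrix.specialUnitaryGroup (Fin 2) ℂ)) {ε : ℝ} (hε : 0 < ε) (hεL : 1000000 * (F.L : ℝ) ^ 5 * ε ≤ 1)
    (hU : ∀ p : Plaq (F.P K) 0, dist1 (GaugeField.plaqHol U₀ p) ≤ ε * (((F.L : ℝ) ^ (K - n)) ^ 2)⁻¹)
    (Q : (k : ℕ) → (PBond (F.P K) 0 → Matrix (Fin 2) (Fin 2) ℂ) → PBond (F.P K) k → Matrix (Fin 2) (Fin 2) ℂ) (hQ0 : ∀ Y, Q 0 Y = Y)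
    (hQs : ∀ (k : ℕ) (Y : PBond (F.P K) 0 → Matrix (Fin 2) (Fin 2) ℂ) (c : PBond (F.P K) (k + 1)), Q (k + 1) Y c
      = (fderiv ℂ (eml : (Idx (F.P K) → Matrix (Fin 2) (Fin 2) ℂ) → Matrix (Fin 2) (Fin 2) ℂ)
            (fun i => ((loopHol (Averaging.iter (fun i => blockAvg (P := (F.P K)) (j := i) (expMeanLogSU (n := Fin 2))) k U₀) c i : Matrix.specialUnitaryGroup (Fin 2) ℂ) : Matrix (Fin 2) (Fin 2) ℂ))
            (fun i => covWalkSum (Averaging.iter (fun i => blockAvg (P := (F.P K)) (j := i) (expMeanLogSU (n := Fin 2))) k U₀) (Q k Y) (walk (emb c.src) (loopWord (F.P K).L c.dir (off i.1) i.2.1 i.2.2))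
              * ((loopHol (Averaging.iter (fun i => blockAvg (P := (F.P K)) (j := i) (expMeanLogSU (n := Fin 2))) k U₀) c i : Matrix.specialUnitaryGroup (Fin 2) ℂ) : Matrix (Fin 2) (Fin 2) ℂ))
            * star ((corr (expMeanLogSU (n := Fin 2)) (Averaging.iter (fun i => blockAvg (P := (F.P K)) (j := i) (expMeanLogSU (n := Fin 2))) k U₀) c : Matrix.specialUnitaryGroup (Fin 2) ℂ) : Matrix (Fin 2) (Fin 2) ℂ)
          + ((corr (expMeanLogSU (n := Fin 2)) (Averaging.iter (fun i => blockAvg (P := (F.P K)) (j := i) (expMeanLogSU (n := Fin 2))) k U₀) c : Matrix.specialUnitaryGroup (Fin 2) ℂ) : Matrix (Fin 2) (Fin 2) ℂ)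
            * covWalkSum (Averaging.iter (fun i => blockAvg (P := (F.P K)) (j := i) (expMeanLogSU (n := Fin 2))) k U₀) (Q k Y) (walk (emb c.src) (List.replicate (F.P K).L (c.dir, true)))
            * star ((corr (expMeanLogSU (n := Fin 2)) (Averaging.iter (fun i => blockAvg (P := (F.P K)) (j := i) (expMeanLogSU (n := Fin 2))) k U₀) c : Matrix.specialUnitaryGroup (Fin 2) ℂ) : Matrix (Fin 2) (Fin 2) ℂ)))
    (R : PBond (F.P K) 0 → Matrix (Fin 2) (Fin 2) ℂ) :
    ∑ c : PBond (F.P K) (K - n), ‖Q (K - n) R c‖ ^ 2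
      ≤ (9 / 2 * ((F.L : ℝ) ^ (K - n))⁻¹ + 576000 * (F.L : ℝ) ^ 4 * ((F.L : ℝ) ^ (K - n)) + 96000000000 * (F.L : ℝ) ^ 9 * ε * ((F.L : ℝ) ^ (K - n))⁻¹)
        * ∑ b : PBond (F.P K) 0, ‖R b‖ ^ 2 := by
  -- T³ letters and the tower sizes (as in ✓ `…FibreLevelMassT3`)
  have hL3 := three_le_L F
  have hLpos : (0 : ℝ) < (F.L : ℝ) := by linarith only [hL3]
  have hLF : (F.P K).L = F.L := rfl
  have hk : K - n ≤ (F.P K).m + (F.P K).K := by show K - n ≤ F.m + K; omega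
  obtain ⟨-, hε3, hε2, hε24, -⟩ := smallness_T3 F K hε hεL
  have hε' : 0 < 2 * ε := by linarith only [hε]
  have hU' : PlaqSmall (2 * ε * ((((F.P K).L : ℝ) ^ (K - n))⁻¹) ^ 2) U₀ := by
    refine plaqSmall_of_le_of_lt hU ?_
    rw [hLF, inv_pow]
    exact mul_lt_mul_of_pos_right (by linarith only [hε]) (inv_pos.mpr (by positivity))
  have hα := loop_size_geom (N := 2) (K - n) hε' hε3 hε2 hU'
  obtain ⟨hale, h24, hN⟩ := size_numerals (N := 2) (K - n) hε' hε2 hε24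
  have ha0 : ∀ j : ℕ, (0 : ℝ) ≤ (((((F.P K).d + 2) * (F.P K).L : ℕ) : ℝ) ^ 2 / 2 * (2 * ε) * ((((F.P K).L : ℝ)) ^ (2 * j) / (((F.P K).L : ℝ)) ^ (2 * (K - n)))) := fun j => by positivity
  obtain ⟨hρ0, hρ1, -, hρ2L⟩ := rho_facts F K
  obtain ⟨hD0, hD12, -⟩ := two_sqrt_d_facts F K
  -- the zero-content recursion families of `R`
  obtain ⟨G, hG0, hGs⟩ := exists_reduced_family (N := 2) U₀ R
  obtain ⟨S, hS0, hSs⟩ := exists_pureLine_family (n := 2) U₀ R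
  obtain ⟨Λ, hΛ0, hΛs⟩ := exists_coarseGauge_family (N := 2) U₀ G
  -- structure theorem at the top level
  have hst := sqrt_sum_normSq_trueLinIter_le_of_structure U₀ hk Q hQ0 hQs R G S Λ hG0 hS0 hΛ0 hΛs hGs hSs
    (fun j => (((((F.P K).d + 2) * (F.P K).L : ℕ) : ℝ) ^ 2 / 2 * (2 * ε) * ((((F.P K).L : ℝ)) ^ (2 * j) / (((F.P K).L : ℝ)) ^ (2 * (K - n))))) ha0 hα
    (fun j hj => (hale j hj).trans h24) (fun j hj => (hale j hj).trans_lt hN)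
  have hE := level_exp_le F n K hε hεL (K - n) le_rfl
  -- the coarse gauge function at the top level, in curl + div + mass currencies, and the stencil bounds
  have hΛ := sum_normSq_covIterLambda_le_level F n K U₀ hε hεL hU R G S Λ hΛ0 hG0 hS0 hΛs hGs hSs (K - n) le_rfl
  have hcurl := sum_hs_curl_le_mass U₀ R
  have hdiv := sum_hs_divB_le U₀ R
  -- letters
  set m : ℝ := ∑ b : PBond (F.P K) 0, ‖R b‖ ^ 2 with hm
  set lam : ℝ := ∑ y : Site (F.P K) (K - n), ‖Λ (K - n) y‖ ^ 2 with hlam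
  set ρ : ℝ := Real.sqrt (((((F.P K).L : ℝ)) ^ (F.P K).d)⁻¹ * (((F.P K).L : ℝ)) ^ 2) with hρ
  set E : ℝ := Real.exp ((159 * ((((F.P K).d + 2) * (F.P K).L : ℕ) : ℝ) * Real.sqrt (2 * (F.P K).d * (((F.P K).L : ℝ)) ^ (F.P K).d * (2 * (F.P K).d))) / Real.sqrt (((((F.P K).L : ℝ)) ^ (F.P K).d)⁻¹ * (((F.P K).L : ℝ)) ^ 2) * ∑ i ∈ Finset.range (K - n), (((((F.P K).d + 2) * (F.P K).L : ℕ) : ℝ) ^ 2 / 2 * (2 * ε) * ((((F.P K).L : ℝ)) ^ (2 * i) / (((F.P K).L : ℝ)) ^ (2 * (K - n))))) with hEdef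
  have hm0 : 0 ≤ m := Finset.sum_nonneg fun _ _ => sq_nonneg _
  have hlam0 : 0 ≤ lam := Finset.sum_nonneg fun _ _ => sq_nonneg _
  have hE0 : 0 ≤ E := (Real.exp_pos _).le
  have hρk2 : (ρ ^ (K - n)) ^ 2 = ((F.L : ℝ) ^ (K - n))⁻¹ := by
    rw [← pow_mul, mul_comm, pow_mul, ← inv_pow]
    have : ρ ^ 2 = (F.L : ℝ)⁻¹ := eq_inv_of_mul_eq_one_left hρ2L
    rw [this]
  -- square the structure bound: `Z ≤ (ρᵏE√m + D√λ)² ≤ 2ρ^{2k}E²m + 2D²λ`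
  have hZ0 : 0 ≤ ∑ c : PBond (F.P K) (K - n), ‖Q (K - n) R c‖ ^ 2 := Finset.sum_nonneg fun _ _ => sq_nonneg _
  have hsq : ∑ c : PBond (F.P K) (K - n), ‖Q (K - n) R c‖ ^ 2 ≤ 2 * ((ρ ^ (K - n)) ^ 2 * E ^ 2 * m) + 2 * ((2 * Real.sqrt (F.P K).d) ^ 2 * lam) := by
    have h1 := pow_le_pow_left₀ (Real.sqrt_nonneg _) hst 2
    rw [Real.sq_sqrt hZ0] at h1
    have e : (ρ ^ (K - n) * E * Real.sqrt m + 2 * Real.sqrt (F.P K).d * Real.sqrt lam) ^ 2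
        = 2 * ((ρ ^ (K - n)) ^ 2 * E ^ 2 * (Real.sqrt m) ^ 2) + 2 * ((2 * Real.sqrt (F.P K).d) ^ 2 * (Real.sqrt lam) ^ 2)
          - (ρ ^ (K - n) * E * Real.sqrt m - 2 * Real.sqrt (F.P K).d * Real.sqrt lam) ^ 2 := by ring
    rw [e, Real.sq_sqrt hm0, Real.sq_sqrt hlam0] at h1
    linarith [h1, sq_nonneg (ρ ^ (K - n) * E * Real.sqrt m - 2 * Real.sqrt (F.P K).d * Real.sqrt lam)]
  -- the reduced part: `ρ^{2k}E² ≤ (9/4)ℓ⁻¹`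
  have hE2 : E ^ 2 ≤ 9 / 4 := by nlinarith [hE, hE0]
  have hred : 2 * ((ρ ^ (K - n)) ^ 2 * E ^ 2 * m) ≤ 9 / 2 * ((F.L : ℝ) ^ (K - n))⁻¹ * m := by
    rw [hρk2]
    have hi0 : 0 ≤ ((F.L : ℝ) ^ (K - n))⁻¹ := by positivity
    have := mul_le_mul_of_nonneg_left (mul_le_mul_of_nonneg_right hE2 hm0) hi0
    nlinarith [this]
  -- the gauge part: `D²λ ≤ 12·ℓ·(200L⁴·120·m + 4·10⁹L⁹εℓ⁻²m)`
  have hgauge : 2 * ((2 * Real.sqrt (F.P K).d) ^ 2 * lam)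
      ≤ 576000 * (F.L : ℝ) ^ 4 * ((F.L : ℝ) ^ (K - n)) * m + 96000000000 * (F.L : ℝ) ^ 9 * ε * ((F.L : ℝ) ^ (K - n))⁻¹ * m := by
    rw [hD12]
    have hcd : (∑ x : Site (F.P K) 0, ∑ μ : Fin (F.P K).d, ∑ ν : Fin (F.P K).d,
            (if μ < ν then ∑ j : Fin 2, ∑ k : Fin 2,
              ‖(curl (torusT (F.P K) 0) (fun κ z => unitsField (toUField U₀) ⟨z, κ⟩) (fun κ z => R ⟨z, κ⟩) μ ν x) j k‖ ^ 2 else 0))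
          + (∑ x : Site (F.P K) 0, ∑ j : Fin 2, ∑ k : Fin 2,
            ‖(divB (torusT (F.P K) 0) (fun κ z => unitsField (toUField U₀) ⟨z, κ⟩) (fun κ z => R ⟨z, κ⟩) x) j k‖ ^ 2) ≤ 120 * m := by
      linarith [hcurl, hdiv]
    have hℓ0 : 0 ≤ (F.L : ℝ) ^ (K - n) := by positivity
    have hL40 : 0 ≤ 200 * (F.L : ℝ) ^ 4 := by positivity
    have h1 := mul_le_mul_of_nonneg_left hcd hL40
    have hε0 : 0 ≤ 4 * 10 ^ 9 * (F.L : ℝ) ^ 9 * ε * (((F.L : ℝ) ^ (K - n)) ^ 2)⁻¹ * m := by positivity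
    have h2 : lam ≤ (F.L : ℝ) ^ (K - n) * (200 * (F.L : ℝ) ^ 4 * (120 * m) + 4 * 10 ^ 9 * (F.L : ℝ) ^ 9 * ε * (((F.L : ℝ) ^ (K - n)) ^ 2)⁻¹ * m) :=
      hΛ.trans (mul_le_mul_of_nonneg_left (by linarith [h1]) hℓ0)
    have e : (F.L : ℝ) ^ (K - n) * (4 * 10 ^ 9 * (F.L : ℝ) ^ 9 * ε * (((F.L : ℝ) ^ (K - n)) ^ 2)⁻¹ * m)
        = 4 * 10 ^ 9 * (F.L : ℝ) ^ 9 * ε * ((F.L : ℝ) ^ (K - n))⁻¹ * m := by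
      have hℓne : (F.L : ℝ) ^ (K - n) ≠ 0 := by positivity
      field_simp
    have h3 : lam ≤ 24000 * (F.L : ℝ) ^ 4 * ((F.L : ℝ) ^ (K - n)) * m + 4 * 10 ^ 9 * (F.L : ℝ) ^ 9 * ε * ((F.L : ℝ) ^ (K - n))⁻¹ * m := by
      rw [mul_add, e] at h2
      linarith [h2]
    linarith [h3]
  calc ∑ c : PBond (F.P K) (K - n), ‖Q (K - n) R c‖ ^ 2
      ≤ 2 * ((ρ ^ (K - n)) ^ 2 * E ^ 2 * m) + 2 * ((2 * Real.sqrt (F.P K).d) ^ 2 * lam) := hsq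
    _ ≤ 9 / 2 * ((F.L : ℝ) ^ (K - n))⁻¹ * m
        + (576000 * (F.L : ℝ) ^ 4 * ((F.L : ℝ) ^ (K - n)) * m + 96000000000 * (F.L : ℝ) ^ 9 * ε * ((F.L : ℝ) ^ (K - n))⁻¹ * m) := add_le_add hred hgauge
    _ = _ := by ring

/-! ## §3 Scalar windows -/

/-- The number of ✓ `twoBlockMass_le_of_plaqBound_T3` at the member: for `j < k`, `L ≥ 3`, `8·10¹¹L⁹sQ ≤ 1`, `10¹⁴L⁹e ≤ 1`,
`2·10¹⁴·L·(4Lʲ(sQ·(Lᵏ)⁻¹ + 2·(3L^{j+1})·(e·((Lᵏ)²)⁻¹))) ≤ 1`. [folklore] -/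
theorem twoBlock_number {L sQ e : ℝ} {j k : ℕ} (hL : 3 ≤ L) (hjk : j < k) (hsQ0 : 0 ≤ sQ) (hsQL : 800000000000 * L ^ 9 * sQ ≤ 1)
    (he0 : 0 ≤ e) (heL : 100000000000000 * L ^ 9 * e ≤ 1) :
    2 * 10 ^ 14 * L * (4 * L ^ j * (sQ * (L ^ k)⁻¹ + 2 * (3 * L ^ (j + 1)) * (e * ((L ^ k) ^ 2)⁻¹))) ≤ 1 := by
  have hL0 : 0 < L := by linarith
  have hL1 : 1 ≤ L := by linarith
  have hk0 : 0 < L ^ k := pow_pos hL0 k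
  have hki : 0 ≤ (L ^ k)⁻¹ := by positivity
  have hjk' : L ^ (j + 1) ≤ L ^ k := pow_le_pow_right₀ hL1 hjk
  -- `L·Lʲ·(Lᵏ)⁻¹ ≤ 1` and `L^{j+1}·(Lᵏ)⁻¹ ≤ 1`
  have hA : L ^ (j + 1) * (L ^ k)⁻¹ ≤ 1 := by
    rw [← div_eq_mul_inv, div_le_one hk0]; exact hjk'
  have hA0 : 0 ≤ L ^ (j + 1) * (L ^ k)⁻¹ := by positivity
  have hL9 : (19683 : ℝ) ≤ L ^ 9 := by
    have := pow_le_pow_left₀ (by norm_num : (0:ℝ) ≤ 3) hL 9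
    norm_num at this; exact this
  have hu : L ^ 9 * sQ ≤ 1 / 800000000000 := by linarith [hsQL]
  have hv : L ^ 9 * e ≤ 1 / 100000000000000 := by linarith [heL]
  -- `sQ ≤ (8·10¹¹·19683)⁻¹`, `e ≤ (10¹⁴·19683)⁻¹`
  have hsQ' : 19683 * sQ ≤ 1 / 800000000000 := by nlinarith [mul_le_mul_of_nonneg_right hL9 hsQ0, hu]
  have he' : 19683 * e ≤ 1 / 100000000000000 := by nlinarith [mul_le_mul_of_nonneg_right hL9 he0, hv]
  -- rewrite the number as `8e14·A·sQ + 4.8e15·A·A'·e`, `A = L^{j+1}(Lᵏ)⁻¹`, `A' = L^{j+1}(Lᵏ)⁻¹`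
  have e1 : 2 * 10 ^ 14 * L * (4 * L ^ j * (sQ * (L ^ k)⁻¹ + 2 * (3 * L ^ (j + 1)) * (e * ((L ^ k) ^ 2)⁻¹)))
      = 800000000000000 * (L ^ (j + 1) * (L ^ k)⁻¹) * sQ + 4800000000000000 * ((L ^ (j + 1) * (L ^ k)⁻¹) * (L ^ (j + 1) * (L ^ k)⁻¹)) * e := by
    rw [pow_succ, ← inv_pow]; ring
  rw [e1]
  have h1 : 800000000000000 * (L ^ (j + 1) * (L ^ k)⁻¹) * sQ ≤ 800000000000000 * 1 * sQ :=
    mul_le_mul_of_nonneg_right (mul_le_mul_of_nonneg_left hA (by norm_num)) hsQ0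
  have hAA : (L ^ (j + 1) * (L ^ k)⁻¹) * (L ^ (j + 1) * (L ^ k)⁻¹) ≤ 1 := by nlinarith [hA, hA0]
  have h2 : 4800000000000000 * ((L ^ (j + 1) * (L ^ k)⁻¹) * (L ^ (j + 1) * (L ^ k)⁻¹)) * e ≤ 4800000000000000 * 1 * e :=
    mul_le_mul_of_nonneg_right (mul_le_mul_of_nonneg_left hAA (by norm_num)) he0
  nlinarith [h1, h2, hsQ', he']

set_option maxHeartbeats 400000 in
/-- **THE MEMBER NUMERALS** (pure reals): the windows `8·10¹¹L⁹sQ ≤ 1`, `10¹⁴L⁹e ≤ 1`, `L ≥ 3`, `ℓ ≥ 1` turn the sharp budget `ZP` (file A2 at `θ = 1872000·L⁷·sQ`), the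
`Z′`-junction `ZR` (§2 at `Σ‖Z′‖² ≤ (2sQℓ⁻¹)²·M`) and the currencies `M₀ ≤ 2M`, `CURL₀ + DIV₀ ≤ 8·KD + (321072s² + 1536(eℓ⁻²)²)·M` into
`2ZP + 2ZR ≤ 1.5·10¹⁹·L¹⁸·sQ²·ℓ⁻¹·M + 2.4·10²²·L²⁰·sQ²·ℓ·KD`. [folklore] -/
theorem member_numerals {L ℓ sQ e M KD M₀ CD ZP ZR : ℝ} (hL : 3 ≤ L) (hℓ : 1 ≤ ℓ) (hsQ0 : 0 ≤ sQ)
    (hsQL : 800000000000 * L ^ 9 * sQ ≤ 1) (he0 : 0 ≤ e) (heL : 100000000000000 * L ^ 9 * e ≤ 1) (hM0 : 0 ≤ M) (hKD : 0 ≤ KD)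
    (hM₀0 : 0 ≤ M₀) (hM₀ : M₀ ≤ 2 * M)
    (hCD : CD ≤ 8 * KD + (321072 * (2 * sQ * ℓ⁻¹) ^ 2 + 1536 * (e * (ℓ ^ 2)⁻¹) ^ 2) * M)
    (hZP : ZP ≤ 2000000 * L ^ 2 * (1872000 * L ^ 7 * sQ) ^ 2 * ℓ * (200 * L ^ 4 * CD + 4 * 10 ^ 9 * L ^ 9 * e * (ℓ ^ 2)⁻¹ * M₀)
        + 1000000 * L ^ 4 * (1872000 * L ^ 7 * sQ) ^ 2 * ℓ⁻¹ * M₀)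
    (hZR : ZR ≤ (9 / 2 * ℓ⁻¹ + 576000 * L ^ 4 * ℓ + 96000000000 * L ^ 9 * e * ℓ⁻¹) * ((2 * sQ * ℓ⁻¹) ^ 2 * M)) :
    2 * ZP + 2 * ZR ≤ 15000000000000000000 * L ^ 18 * sQ ^ 2 * ℓ⁻¹ * M + 24000000000000000000000 * L ^ 20 * sQ ^ 2 * ℓ * KD := by
  -- scalar windows
  have hL0 : 0 < L := by linarith
  have hL1 : 1 ≤ L := by linarith
  have hℓ0 : 0 < ℓ := by linarith
  have hℓi0 : 0 ≤ ℓ⁻¹ := by positivity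
  have hℓi1 : ℓ⁻¹ ≤ 1 := inv_le_one_of_one_le₀ hℓ
  have hℓℓi : ℓ * ℓ⁻¹ = 1 := mul_inv_cancel₀ hℓ0.ne'
  have hL9 : (1 : ℝ) ≤ L ^ 9 := one_le_pow₀ hL1
  have hu : L ^ 9 * sQ ≤ 1 / 800000000000 := by linarith [hsQL]
  have hv : L ^ 9 * e ≤ 1 / 100000000000000 := by linarith [heL]
  have hu0 : 0 ≤ L ^ 9 * sQ := by positivity
  have hv0 : 0 ≤ L ^ 9 * e := by positivity
  -- the basic nonnegative monomials `X := L¹⁸ sQ² ℓ⁻¹ M`, `Y := L²⁰ sQ² ℓ KD`, `X₂ := L² sQ² ℓ⁻¹ M`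
  have hX0 : 0 ≤ L ^ 18 * sQ ^ 2 * ℓ⁻¹ * M := by positivity
  have hY0 : 0 ≤ L ^ 20 * sQ ^ 2 * ℓ * KD := by positivity
  have hX20 : 0 ≤ L ^ 2 * sQ ^ 2 * ℓ⁻¹ * M := by positivity
  have hL16 : L ^ 2 * sQ ^ 2 * ℓ⁻¹ * M ≤ L ^ 18 * sQ ^ 2 * ℓ⁻¹ * M := by
    have h : L ^ 2 ≤ L ^ 18 := pow_le_pow_right₀ hL1 (by norm_num)
    have h0 : 0 ≤ sQ ^ 2 * ℓ⁻¹ * M := by positivity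
    have h1 := mul_le_mul_of_nonneg_right h h0
    have e1 : L ^ 2 * sQ ^ 2 * ℓ⁻¹ * M = L ^ 2 * (sQ ^ 2 * ℓ⁻¹ * M) := by ring
    have e2 : L ^ 18 * sQ ^ 2 * ℓ⁻¹ * M = L ^ 18 * (sQ ^ 2 * ℓ⁻¹ * M) := by ring
    rw [e1, e2]; exact h1
  -- letters
  have hT2 : (1872000 * L ^ 7 * sQ) ^ 2 = 3504384000000 * L ^ 14 * sQ ^ 2 := by ring
  have hs2 : (2 * sQ * ℓ⁻¹) ^ 2 = 4 * sQ ^ 2 * ℓ⁻¹ ^ 2 := by ring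
  have he2 : (e * (ℓ ^ 2)⁻¹) ^ 2 = e ^ 2 * ℓ⁻¹ ^ 4 := by rw [← inv_pow]; ring
  -- (K) the curvature∕divergence part
  have hK : 2 * (2000000 * L ^ 2 * (1872000 * L ^ 7 * sQ) ^ 2 * ℓ * (200 * L ^ 4 * (8 * KD))) ≤ 24000000000000000000000 * (L ^ 20 * sQ ^ 2 * ℓ * KD) := by
    rw [hT2]
    have e1 : 2 * (2000000 * L ^ 2 * (3504384000000 * L ^ 14 * sQ ^ 2) * ℓ * (200 * L ^ 4 * (8 * KD))) = 22428057600000000000000 * (L ^ 20 * sQ ^ 2 * ℓ * KD) := by ring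
    rw [e1]
    linarith [hY0]
  -- (i) the `s²`-mass piece of CD: `≤ 6000·X`
  have hi : 2 * (2000000 * L ^ 2 * (1872000 * L ^ 7 * sQ) ^ 2 * ℓ * (200 * L ^ 4 * (321072 * (2 * sQ * ℓ⁻¹) ^ 2 * M))) ≤ 6000 * (L ^ 18 * sQ ^ 2 * ℓ⁻¹ * M) := by
    rw [hT2, hs2]
    have e1 : 2 * (2000000 * L ^ 2 * (3504384000000 * L ^ 14 * sQ ^ 2) * ℓ * (200 * L ^ 4 * (321072 * (4 * sQ ^ 2 * ℓ⁻¹ ^ 2) * M)))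
        = 3600510654873600000000000000 * ((L ^ 9 * sQ) ^ 2 * (ℓ * ℓ⁻¹)) * (L ^ 2 * sQ ^ 2 * ℓ⁻¹ * M) := by ring
    rw [e1, hℓℓi, mul_one]
    have hu2 : (L ^ 9 * sQ) ^ 2 ≤ (1 / 800000000000) ^ 2 := pow_le_pow_left₀ hu0 hu 2
    have h1 := mul_le_mul_of_nonneg_right hu2 hX20
    linarith [h1, hL16, hX20]
  -- (ii) the `e²`-mass piece of CD: `≤ X`
  have hii : 2 * (2000000 * L ^ 2 * (1872000 * L ^ 7 * sQ) ^ 2 * ℓ * (200 * L ^ 4 * (1536 * (e * (ℓ ^ 2)⁻¹) ^ 2 * M))) ≤ L ^ 18 * sQ ^ 2 * ℓ⁻¹ * M := by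
    rw [hT2, he2]
    have e1 : 2 * (2000000 * L ^ 2 * (3504384000000 * L ^ 14 * sQ ^ 2) * ℓ * (200 * L ^ 4 * (1536 * (e ^ 2 * ℓ⁻¹ ^ 4) * M)))
        = 4306187059200000000000000 * ((L ^ 9 * e) ^ 2 * ℓ⁻¹ ^ 2 * (ℓ * ℓ⁻¹)) * (L ^ 2 * sQ ^ 2 * ℓ⁻¹ * M) := by ring
    rw [e1, hℓℓi, mul_one]
    have hv2 : (L ^ 9 * e) ^ 2 ≤ (1 / 100000000000000) ^ 2 := pow_le_pow_left₀ hv0 hv 2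
    have hℓ2 : ℓ⁻¹ ^ 2 ≤ 1 := pow_le_one₀ hℓi0 hℓi1
    have hprod : (L ^ 9 * e) ^ 2 * ℓ⁻¹ ^ 2 ≤ (1 / 100000000000000) ^ 2 * 1 := mul_le_mul hv2 hℓ2 (by positivity) (by positivity)
    have h1 := mul_le_mul_of_nonneg_right hprod hX20
    linarith [h1, hL16, hX20]
  -- (iii) the `e`-mass term: `≤ 1.2e15·X`
  have hiii : 2 * (2000000 * L ^ 2 * (1872000 * L ^ 7 * sQ) ^ 2 * ℓ * (4 * 10 ^ 9 * L ^ 9 * e * (ℓ ^ 2)⁻¹ * M₀)) ≤ 1200000000000000 * (L ^ 18 * sQ ^ 2 * ℓ⁻¹ * M) := by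
    rw [hT2]
    have e1 : 2 * (2000000 * L ^ 2 * (3504384000000 * L ^ 14 * sQ ^ 2) * ℓ * (4 * 10 ^ 9 * L ^ 9 * e * (ℓ ^ 2)⁻¹ * M₀))
        = 56070144000000000000000000000 * (L ^ 9 * e) * ((ℓ * ℓ⁻¹) * (L ^ 16 * sQ ^ 2 * ℓ⁻¹ * M₀)) := by
      rw [← inv_pow]; ring
    rw [e1, hℓℓi, one_mul]
    have hsmall : 0 ≤ L ^ 16 * sQ ^ 2 * ℓ⁻¹ * M₀ := by positivity
    have h1 := mul_le_mul_of_nonneg_right hv hsmall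
    -- `L¹⁶ sQ² ℓ⁻¹ M₀ ≤ 2·X`
    have h16 : L ^ 16 ≤ L ^ 18 := pow_le_pow_right₀ hL1 (by norm_num)
    have h0 : 0 ≤ sQ ^ 2 * ℓ⁻¹ := by positivity
    have h2 : L ^ 16 * (sQ ^ 2 * ℓ⁻¹) ≤ L ^ 18 * (sQ ^ 2 * ℓ⁻¹) := mul_le_mul_of_nonneg_right h16 h0
    have h3 : 0 ≤ L ^ 18 * (sQ ^ 2 * ℓ⁻¹) := by positivity
    have h4 : L ^ 16 * (sQ ^ 2 * ℓ⁻¹) * M₀ ≤ L ^ 18 * (sQ ^ 2 * ℓ⁻¹) * (2 * M) := mul_le_mul h2 hM₀ hM₀0 h3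
    have e2 : L ^ 16 * sQ ^ 2 * ℓ⁻¹ * M₀ = L ^ 16 * (sQ ^ 2 * ℓ⁻¹) * M₀ := by ring
    have e3 : L ^ 18 * (sQ ^ 2 * ℓ⁻¹) * (2 * M) = 2 * (L ^ 18 * sQ ^ 2 * ℓ⁻¹ * M) := by ring
    rw [e2] at h1 hsmall
    rw [e3] at h4
    linarith [h1, h4, hsmall]
  -- (iv) the pure mass term: `≤ 14017536000000000000·X`
  have hiv : 2 * (1000000 * L ^ 4 * (1872000 * L ^ 7 * sQ) ^ 2 * ℓ⁻¹ * M₀) ≤ 14017536000000000000 * (L ^ 18 * sQ ^ 2 * ℓ⁻¹ * M) := by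
    rw [hT2]
    have e1 : 2 * (1000000 * L ^ 4 * (3504384000000 * L ^ 14 * sQ ^ 2) * ℓ⁻¹ * M₀) = 7008768000000000000 * ((L ^ 18 * sQ ^ 2 * ℓ⁻¹) * M₀) := by ring
    rw [e1]
    have h3 : 0 ≤ L ^ 18 * sQ ^ 2 * ℓ⁻¹ := by positivity
    have h4 := mul_le_mul_of_nonneg_left hM₀ h3
    have e3 : L ^ 18 * sQ ^ 2 * ℓ⁻¹ * (2 * M) = 2 * (L ^ 18 * sQ ^ 2 * ℓ⁻¹ * M) := by ring
    rw [e3] at h4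
    linarith [h4]
  -- (v) the `Z′`-junction: `2·ZR ≤ 2·X`
  have hv' : 2 * ((9 / 2 * ℓ⁻¹ + 576000 * L ^ 4 * ℓ + 96000000000 * L ^ 9 * e * ℓ⁻¹) * ((2 * sQ * ℓ⁻¹) ^ 2 * M)) ≤ 2 * (L ^ 18 * sQ ^ 2 * ℓ⁻¹ * M) := by
    rw [hs2]
    have e1 : 2 * ((9 / 2 * ℓ⁻¹ + 576000 * L ^ 4 * ℓ + 96000000000 * L ^ 9 * e * ℓ⁻¹) * (4 * sQ ^ 2 * ℓ⁻¹ ^ 2 * M))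
        = (36 * ℓ⁻¹ ^ 2 + 4608000 * L ^ 4 * (ℓ * ℓ⁻¹) + 768000000000 * (L ^ 9 * e) * ℓ⁻¹ ^ 2) * (sQ ^ 2 * ℓ⁻¹ * M) := by ring
    rw [e1, hℓℓi, mul_one]
    have hℓ2 : ℓ⁻¹ ^ 2 ≤ 1 := pow_le_one₀ hℓi0 hℓi1
    have hℓ20 : 0 ≤ ℓ⁻¹ ^ 2 := by positivity
    have h1 : 768000000000 * (L ^ 9 * e) * ℓ⁻¹ ^ 2 ≤ 768000000000 * (1 / 100000000000000) * 1 :=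
      mul_le_mul (mul_le_mul_of_nonneg_left hv (by norm_num)) hℓ2 hℓ20 (by positivity)
    have hc : 36 * ℓ⁻¹ ^ 2 + 4608000 * L ^ 4 + 768000000000 * (L ^ 9 * e) * ℓ⁻¹ ^ 2 ≤ 37 + 4608000 * L ^ 4 := by
      linarith [h1, hℓ2]
    have hL4 : 37 + 4608000 * L ^ 4 ≤ 2 * L ^ 18 := by
      have h81 : (81 : ℝ) ≤ L ^ 4 := by
        have := pow_le_pow_left₀ (by norm_num : (0:ℝ) ≤ 3) hL 4
        norm_num at this; exact this
      have h14 : (4782969 : ℝ) ≤ L ^ 14 := by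
        have := pow_le_pow_left₀ (by norm_num : (0:ℝ) ≤ 3) hL 14
        norm_num at this; exact this
      have e2 : L ^ 18 = L ^ 4 * L ^ 14 := by ring
      rw [e2]
      have hL40 : (0:ℝ) ≤ L ^ 4 := by positivity
      have := mul_le_mul_of_nonneg_left h14 hL40
      nlinarith [this, h81]
    have h0 : 0 ≤ sQ ^ 2 * ℓ⁻¹ * M := by positivity
    have h5 := mul_le_mul_of_nonneg_right (hc.trans hL4) h0
    have e3 : 2 * L ^ 18 * (sQ ^ 2 * ℓ⁻¹ * M) = 2 * (L ^ 18 * sQ ^ 2 * ℓ⁻¹ * M) := by ring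
    rw [e3] at h5
    exact h5
  -- assemble: split `hZP` along `hCD`
  have hθ0 : 0 ≤ 2000000 * L ^ 2 * (1872000 * L ^ 7 * sQ) ^ 2 * ℓ * (200 * L ^ 4) := by positivity
  have hCD1 := mul_le_mul_of_nonneg_left hCD hθ0
  have e4 : 2000000 * L ^ 2 * (1872000 * L ^ 7 * sQ) ^ 2 * ℓ * (200 * L ^ 4 * CD + 4 * 10 ^ 9 * L ^ 9 * e * (ℓ ^ 2)⁻¹ * M₀)
      = 2000000 * L ^ 2 * (1872000 * L ^ 7 * sQ) ^ 2 * ℓ * (200 * L ^ 4) * CD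
        + 2000000 * L ^ 2 * (1872000 * L ^ 7 * sQ) ^ 2 * ℓ * (4 * 10 ^ 9 * L ^ 9 * e * (ℓ ^ 2)⁻¹ * M₀) := by ring
  have e5 : 2000000 * L ^ 2 * (1872000 * L ^ 7 * sQ) ^ 2 * ℓ * (200 * L ^ 4) * (8 * KD + (321072 * (2 * sQ * ℓ⁻¹) ^ 2 + 1536 * (e * (ℓ ^ 2)⁻¹) ^ 2) * M)
      = 2000000 * L ^ 2 * (1872000 * L ^ 7 * sQ) ^ 2 * ℓ * (200 * L ^ 4 * (8 * KD))
        + 2000000 * L ^ 2 * (1872000 * L ^ 7 * sQ) ^ 2 * ℓ * (200 * L ^ 4 * (321072 * (2 * sQ * ℓ⁻¹) ^ 2 * M))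
        + 2000000 * L ^ 2 * (1872000 * L ^ 7 * sQ) ^ 2 * ℓ * (200 * L ^ 4 * (1536 * (e * (ℓ ^ 2)⁻¹) ^ 2 * M)) := by ring
  rw [e4] at hZP
  rw [e5] at hCD1
  linarith [hZP, hCD1, hZR, hK, hi, hii, hiii, hiv, hv', hX0, hY0]

end Summit.QuantumFields.YangMills.Theorems.Prop7LinAvgDefectLetters

end
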